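import Summits.CriticalPhenomena.PercolationContinuityZ3.Theorems.PercNearOneGluingNoHeavyLowerTailSahiCTCC2LevelTwo
import HarnessLib

/-!
# `NoHeavyLowerTail` (crux stmt-CriticalPhenomena-4575), P3 lane: the TOP SLICE of `R_{t+1}` at a vertex is `R_t` of the section cylinders —
# hence the one-vertex monotonicity C2 at level `t+1` holds at every profile with a tripled vertex as soon as C2 holds at level `t`;
# at level `3` this is unconditional (C2 at level `2` is `…SahiCTCC2LevelTwo.coeff_Rt_two_C2`)

Support file (seat `prim-l12-p3`, gen 43; `--supports stmt-CriticalPhenomena-4575`).  Memo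
`run/shared/lean/prim/prim-l12/FROM-prim-l12-p3-g43-C2-LEVEL-THREE.md` §2.  For a vertex `w` and a family `F ⊆ 2^α` the `1`-section cylinder is
`cyl w F = {S : S + w ∈ F}` (an up-set when `F` is; it does not read `w`).  THIS FILE:
* `coeff_gf_mul_congr_of_agree` : at a `w`-free profile the coefficient of `GF(A)·Q` only sees the `w`-free members of `A`;
* `coeff_gf3_add_single_three` : for `w`-free `n`, `coeff_{n+3e_w}(GF(A)GF(B)GF(C)) = coeff_n(GF(cyl A)GF(cyl B)GF(cyl C))` (every one of the three
  sets must contain `w`);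
* **`coeff_Rt_succ_add_single_three`** : `coeff_{n+3e_w} R_{t+1}(𝒳,𝒵) = coeff_n R_t(cyl 𝒳, cyl 𝒵)` for `w`-free `n` (the small world `{#S < t+1}`,
  the large common members and the small members all drop one level through the cylinder);
* `coeff_Rt_eq_zero_of_four_le` : a coefficient of `R_t` vanishes at any profile with an entry `≥ 4`;
* **`coeff_Rt_succ_C2_of_three_le`** : if C2 holds at level `t` for every pair of up-sets, then C2 at level `t+1` holds at every vertex `v` and every
  profile having an entry `≥ 3` at some vertex `w ≠ v`;  **`coeff_Rt_three_C2_of_three_le`** : the level-`3` instance, unconditional.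
So the conjecture C2 at level `3` (memo g27 §4.2 `G_3 ∈ ℕ[s]`, equivalently `R_3 ∈ ℕ[s]` via `…SahiCTCLumpedVertex.coeff_Rlump_nonneg_of_C2`) is reduced to
the profiles all of whose entries off `v` are `≤ 2`.  Nothing is asserted about the crux; C2 at level `3` in general is NOT proved here.
-/

noncomputable section

open scoped Classical

namespace Summit.CriticalPhenomena.PercolationContinuityZ3.Theorems.SahiCTCForms

open Finset MvPolynomial SahiCTCGenFun

variable {α : Type*} [DecidableEq α] [Fintype α]

/-! ### The section cylinder at a vertex -/

/-- The `1`-section cylinder of `F` at `w`: all sets `S` with `S + w ∈ F`. [this work] -/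
def cyl (w : α) (F : Finset (Finset α)) : Finset (Finset α) := univ.filter fun S => insert w S ∈ F

/-- Membership in the cylinder. [this work] -/
theorem mem_cyl {w : α} {F : Finset (Finset α)} {S : Finset α} : S ∈ cyl w F ↔ insert w S ∈ F := by
  unfold cyl; rw [mem_filter]; exact ⟨fun h => h.2, fun h => ⟨mem_univ _, h⟩⟩

/-- The cylinder of an up-set is an up-set. [this work] -/
theorem isUpperSet_cyl {F : Finset (Finset α)} (hF : IsUpperSet (F : Set (Finset α))) (w : α) :
    IsUpperSet ((cyl w F : Finset (Finset α)) : Set (Finset α)) := by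
  intro a b hab ha
  rw [Finset.mem_coe, mem_cyl] at ha ⊢
  exact hF (insert_subset_insert w hab) ha

/-- The cylinder commutes with intersection. [this work] -/
theorem cyl_inter (w : α) (F G : Finset (Finset α)) : cyl w (F ∩ G) = cyl w F ∩ cyl w G := by
  ext S; simp only [mem_cyl, mem_inter]

/-- On `w`-free sets the link and the cylinder agree. [this work] -/
theorem mem_linkV_iff_mem_cyl {w : α} {F : Finset (Finset α)} {S : Finset α} (hS : w ∉ S) : S ∈ linkV w F ↔ S ∈ cyl w F := by
  rw [mem_cyl]
  unfold linkV
  rw [mem_filter, mem_powerset]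
  exact ⟨fun h => h.2, fun h => ⟨subset_erase.2 ⟨subset_univ _, hS⟩, h⟩⟩

/-! ### Coefficients at `w`-free profiles only see `w`-free members -/

omit [Fintype α] in
/-- A set fitting under a `w`-free profile avoids `w`. [this work] -/
theorem not_mem_of_ind_le {w : α} {S : Finset α} {n : α →₀ ℕ} (hn : n w = 0) (h : ind S ≤ n) : w ∉ S := by
  intro hw
  have h1 := h w
  rw [ind_apply, if_pos hw, hn] at h1
  exact absurd h1 (by norm_num)

omit [Fintype α] in
/-- **Congruence**: if `A` and `A'` have the same `w`-free members then `GF(A)·Q` and `GF(A')·Q` have the same coefficient at every `w`-free profile. [this work] -/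
theorem coeff_gf_mul_congr_of_agree {w : α} {A A' : Finset (Finset α)} (h : ∀ S : Finset α, w ∉ S → (S ∈ A ↔ S ∈ A'))
    (Q : MvPolynomial α ℤ) {n : α →₀ ℕ} (hn : n w = 0) : (gf A * Q).coeff n = (gf A' * Q).coeff n := by
  rw [coeff_gf_mul, coeff_gf_mul]
  refine sum_congr ?_ fun _ _ => rfl
  ext S
  simp only [mem_filter]
  constructor
  · rintro ⟨hS, hle⟩; exact ⟨(h S (not_mem_of_ind_le hn hle)).1 hS, hle⟩
  · rintro ⟨hS, hle⟩; exact ⟨(h S (not_mem_of_ind_le hn hle)).2 hS, hle⟩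

omit [Fintype α] in
/-- The same congruence for a triple product `GF(A)·GF(B)·GF(C)`, replacing all three families. [this work] -/
theorem coeff_gf3_congr_of_agree {w : α} {A A' B B' C C' : Finset (Finset α)}
    (hA : ∀ S : Finset α, w ∉ S → (S ∈ A ↔ S ∈ A')) (hB : ∀ S : Finset α, w ∉ S → (S ∈ B ↔ S ∈ B'))
    (hC : ∀ S : Finset α, w ∉ S → (S ∈ C ↔ S ∈ C')) {n : α →₀ ℕ} (hn : n w = 0) :
    (gf A * gf B * gf C).coeff n = (gf A' * gf B' * gf C').coeff n := by
  have e1 : (gf A * gf B * gf C).coeff n = (gf A' * gf B * gf C).coeff n := by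
    rw [mul_assoc, mul_assoc]; exact coeff_gf_mul_congr_of_agree hA _ hn
  have e2 : (gf A' * gf B * gf C).coeff n = (gf A' * gf B' * gf C).coeff n := by
    rw [show gf A' * gf B * gf C = gf B * (gf A' * gf C) by ring, show gf A' * gf B' * gf C = gf B' * (gf A' * gf C) by ring]
    exact coeff_gf_mul_congr_of_agree hB _ hn
  have e3 : (gf A' * gf B' * gf C).coeff n = (gf A' * gf B' * gf C').coeff n := by
    rw [show gf A' * gf B' * gf C = gf C * (gf A' * gf B') by ring, show gf A' * gf B' * gf C' = gf C' * (gf A' * gf B') by ring]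
    exact coeff_gf_mul_congr_of_agree hC _ hn
  rw [e1, e2, e3]

/-! ### The top slice of a triple product -/

/-- **Top slice of a triple product**: at `n + 3e_w` (`n` `w`-free) every one of the three sets contains `w`, so the coefficient is the coefficient at `n`
of the product of the three cylinders. [this work] -/
theorem coeff_gf3_add_single_three (A B C : Finset (Finset α)) (w : α) {n : α →₀ ℕ} (hn : n w = 0) :
    (gf A * gf B * gf C).coeff (n + Finsupp.single w 3) = (gf (cyl w A) * gf (cyl w B) * gf (cyl w C)).coeff n := by
  -- vertex split of the three generating functions
  have hd : ∀ K : Finset (Finset α), ∀ m : α →₀ ℕ, m w ≠ 0 → (gf (delV w K)).coeff m = 0 :=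
    fun K => vfree_gf fun S hS => not_mem_of_mem_delV hS
  have hl : ∀ K : Finset (Finset α), ∀ m : α →₀ ℕ, m w ≠ 0 → (gf (linkV w K)).coeff m = 0 :=
    fun K => vfree_gf fun S hS => not_mem_of_mem_linkV hS
  set dA := gf (delV w A) with hdA
  set dB := gf (delV w B) with hdB
  set dC := gf (delV w C) with hdC
  set lA := gf (linkV w A) with hlA
  set lB := gf (linkV w B) with hlB
  set lC := gf (linkV w C) with hlC
  have hexp : gf A * gf B * gf C = X w ^ 0 * (dA * dB * dC) + X w ^ 1 * (lA * dB * dC + dA * lB * dC + dA * dB * lC)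
      + X w ^ 2 * (lA * lB * dC + lA * dB * lC + dA * lB * lC) + X w ^ 3 * (lA * lB * lC) := by
    rw [gf_eq_delV_add_linkV w A, gf_eq_delV_add_linkV w B, gf_eq_delV_add_linkV w C]
    ring
  have v0 : ∀ m : α →₀ ℕ, m w ≠ 0 → (dA * dB * dC).coeff m = 0 := vfree_mul (vfree_mul (hd _) (hd _)) (hd _)
  have v1 : ∀ m : α →₀ ℕ, m w ≠ 0 → (lA * dB * dC + dA * lB * dC + dA * dB * lC).coeff m = 0 :=
    vfree_add (vfree_add (vfree_mul (vfree_mul (hl _) (hd _)) (hd _)) (vfree_mul (vfree_mul (hd _) (hl _)) (hd _)))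
      (vfree_mul (vfree_mul (hd _) (hd _)) (hl _))
  have v2 : ∀ m : α →₀ ℕ, m w ≠ 0 → (lA * lB * dC + lA * dB * lC + dA * lB * lC).coeff m = 0 :=
    vfree_add (vfree_add (vfree_mul (vfree_mul (hl _) (hl _)) (hd _)) (vfree_mul (vfree_mul (hl _) (hd _)) (hl _)))
      (vfree_mul (vfree_mul (hd _) (hl _)) (hl _))
  have v3 : ∀ m : α →₀ ℕ, m w ≠ 0 → (lA * lB * lC).coeff m = 0 := vfree_mul (vfree_mul (hl _) (hl _)) (hl _)
  rw [hexp, coeff_add, coeff_add, coeff_add, coeff_X_pow_mul_of_vfree v0 0 3 hn, coeff_X_pow_mul_of_vfree v1 1 3 hn,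
    coeff_X_pow_mul_of_vfree v2 2 3 hn, coeff_X_pow_mul_of_vfree v3 3 3 hn]
  simp only [show (0 : ℕ) ≠ 3 by norm_num, show (1 : ℕ) ≠ 3 by norm_num, show (2 : ℕ) ≠ 3 by norm_num, if_false, if_true, zero_add]
  -- on `w`-free sets the links are the cylinders
  exact coeff_gf3_congr_of_agree (fun S hS => mem_linkV_iff_mem_cyl hS) (fun S hS => mem_linkV_iff_mem_cyl hS)
    (fun S hS => mem_linkV_iff_mem_cyl hS) hn

/-! ### The top slice of `R_{t+1}` is `R_t` of the cylinders -/

/-- The cylinder of the whole power set is the whole power set. [this work] -/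
theorem cyl_powerset_univ (w : α) : cyl w (univ.powerset : Finset (Finset α)) = univ.powerset := by
  ext S; simp only [mem_cyl, mem_powerset, subset_univ]

/-- On `w`-free sets, the cylinder of `{#S < t+1}` is `{#S < t}`. [this work] -/
theorem mem_cyl_bySize_lt_succ_iff {w : α} {t : ℕ} {S : Finset α} (hS : w ∉ S) :
    S ∈ cyl w (bySize (· < t + 1) : Finset (Finset α)) ↔ S ∈ (bySize (· < t) : Finset (Finset α)) := by
  rw [mem_cyl, mem_bySize_iff, mem_bySize_iff, card_insert_of_notMem hS]; omega

/-- On `w`-free sets, the cylinder of the common members of size `≥ t+1` is the family of common members of the cylinders of size `≥ t`. [this work] -/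
theorem mem_cyl_atLeast_succ_iff {w : α} {t : ℕ} {F G : Finset (Finset α)} {S : Finset α} (hS : w ∉ S) :
    S ∈ cyl w (atLeast (t + 1) (F ∩ G)) ↔ S ∈ atLeast t (cyl w F ∩ cyl w G) := by
  unfold atLeast
  rw [mem_cyl, mem_filter, mem_filter, mem_inter, mem_inter, mem_cyl, mem_cyl, card_insert_of_notMem hS]
  exact and_congr Iff.rfl (by omega)

/-- On `w`-free sets, the cylinder of the members of size `< t+1` is the family of members of the cylinder of size `< t`. [this work] -/
theorem mem_cyl_below_succ_iff {w : α} {t : ℕ} {F : Finset (Finset α)} {S : Finset α} (hS : w ∉ S) :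
    S ∈ cyl w (below (t + 1) F) ↔ S ∈ below t (cyl w F) := by
  unfold below
  rw [mem_cyl, mem_filter, mem_filter, mem_cyl, card_insert_of_notMem hS]
  exact and_congr Iff.rfl (by omega)

/-- `R_t` written as three triple products. [this work] -/
theorem Rt_eq_three_products (t : ℕ) (F G : Finset (Finset α)) :
    Rt t F G = gf (bySize (· < t)) * gf (univ.powerset : Finset (Finset α)) * gf (atLeast t (F ∩ G))
      - gf (bySize (· < t)) * gf F * gf G + gf (univ.powerset : Finset (Finset α)) * gf (below t F) * gf (below t G) := by
  unfold Rt PiP; ring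

/-- **The top slice of `R_{t+1}` at `w` is `R_t` of the cylinders**: `coeff_{n+3e_w} R_{t+1}(𝒳,𝒵) = coeff_n R_t(cyl_w 𝒳, cyl_w 𝒵)` for `w`-free `n`. [this work] -/
theorem coeff_Rt_succ_add_single_three (t : ℕ) (F G : Finset (Finset α)) (w : α) {n : α →₀ ℕ} (hn : n w = 0) :
    (Rt (t + 1) F G).coeff (n + Finsupp.single w 3) = (Rt t (cyl w F) (cyl w G)).coeff n := by
  rw [Rt_eq_three_products, Rt_eq_three_products, coeff_add, coeff_sub, coeff_add, coeff_sub,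
    coeff_gf3_add_single_three _ _ _ w hn, coeff_gf3_add_single_three _ _ _ w hn, coeff_gf3_add_single_three _ _ _ w hn]
  have hP : ∀ S : Finset α, w ∉ S → (S ∈ cyl w (univ.powerset : Finset (Finset α)) ↔ S ∈ (univ.powerset : Finset (Finset α))) :=
    fun S _ => by rw [cyl_powerset_univ]
  rw [coeff_gf3_congr_of_agree (fun S hS => mem_cyl_bySize_lt_succ_iff hS) hP (fun S hS => mem_cyl_atLeast_succ_iff hS) hn,
    coeff_gf3_congr_of_agree (fun S hS => mem_cyl_bySize_lt_succ_iff hS) (fun S _ => Iff.rfl) (fun S _ => Iff.rfl) hn,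
    coeff_gf3_congr_of_agree hP (fun S hS => mem_cyl_below_succ_iff hS) (fun S hS => mem_cyl_below_succ_iff (F := G) hS) hn]

/-! ### Profiles with an entry `≥ 4` -/

omit [Fintype α] in
/-- A triple product of generating functions has no monomial with an exponent `≥ 4`. [this work] -/
theorem coeff_gf3_eq_zero_of_four_le (A B C : Finset (Finset α)) {m : α →₀ ℕ} {w : α} (hw : 4 ≤ m w) :
    (gf A * gf B * gf C).coeff m = 0 := by
  rw [mul_assoc, coeff_gf_mul]
  refine sum_eq_zero fun S hS => coeff_gf_mul_gf_eq_zero _ _ fun h => ?_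
  have h1 := h w
  have h2 : (m - ind S) w = m w - ind S w := Finsupp.tsub_apply _ _ _
  have h3 : ind S w ≤ 1 := by rw [ind_apply]; split_ifs <;> norm_num
  omega

/-- **A coefficient of `R_t` vanishes at every profile with an entry `≥ 4`.** [this work] -/
theorem coeff_Rt_eq_zero_of_four_le (t : ℕ) (F G : Finset (Finset α)) {m : α →₀ ℕ} {w : α} (hw : 4 ≤ m w) :
    (Rt t F G).coeff m = 0 := by
  rw [Rt_eq_three_products, coeff_add, coeff_sub, coeff_gf3_eq_zero_of_four_le _ _ _ hw, coeff_gf3_eq_zero_of_four_le _ _ _ hw,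
    coeff_gf3_eq_zero_of_four_le _ _ _ hw, sub_zero, zero_add]

/-! ### C2 at a tripled vertex -/

/-- **C2 at level `t+1` at every profile with an entry `≥ 3` off the distinguished vertex, from C2 at level `t`.**  If for every pair of up-sets
`coeff_{m+e_v} R_t ≤ coeff_m R_t` whenever `m_v = 2`, then for up-sets `𝒳, 𝒵`, vertices `v ≠ w` and every profile `m` with `m_v = 2` and `m_w ≥ 3`,
`coeff_{m+e_v} R_{t+1}(𝒳,𝒵) ≤ coeff_m R_{t+1}(𝒳,𝒵)` (entry `3`: the top slice is `R_t` of the cylinders; entry `≥ 4`: both sides vanish). [this work] -/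
theorem coeff_Rt_succ_C2_of_three_le {t : ℕ}
    (hC2 : ∀ (F G : Finset (Finset α)), IsUpperSet (F : Set (Finset α)) → IsUpperSet (G : Set (Finset α)) →
      ∀ (m : α →₀ ℕ) (v : α), m v = 2 → (Rt t F G).coeff (m + Finsupp.single v 1) ≤ (Rt t F G).coeff m)
    {F G : Finset (Finset α)} (hF : IsUpperSet (F : Set (Finset α))) (hG : IsUpperSet (G : Set (Finset α)))
    {m : α →₀ ℕ} {v w : α} (hvw : v ≠ w) (hv : m v = 2) (hw : 3 ≤ m w) :
    (Rt (t + 1) F G).coeff (m + Finsupp.single v 1) ≤ (Rt (t + 1) F G).coeff m := by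
  by_cases h4 : 4 ≤ m w
  · have h4' : 4 ≤ (m + Finsupp.single v 1 : α →₀ ℕ) w := by
      rw [Finsupp.add_apply, Finsupp.single_apply, if_neg hvw]; omega
    rw [coeff_Rt_eq_zero_of_four_le _ _ _ h4, coeff_Rt_eq_zero_of_four_le _ _ _ h4']
  · have h3 : m w = 3 := by omega
    -- `m = n + 3e_w` with `n` `w`-free
    set n := m - Finsupp.single w 3 with hn
    have hnw : n w = 0 := by rw [hn, Finsupp.tsub_apply, Finsupp.single_eq_same, h3]
    have hm : m = n + Finsupp.single w 3 := by
      rw [hn, tsub_add_cancel_of_le]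
      rw [Finsupp.single_le_iff, h3]
    have hnv : n v = 2 := by
      rw [hn, Finsupp.tsub_apply, Finsupp.single_apply, if_neg hvw.symm, hv]; rfl
    have hm1 : m + Finsupp.single v 1 = (n + Finsupp.single v 1) + Finsupp.single w 3 := by rw [hm]; abel
    have hn1 : (n + Finsupp.single v 1 : α →₀ ℕ) w = 0 := by
      rw [Finsupp.add_apply, Finsupp.single_apply, if_neg hvw, hnw]; rfl
    rw [hm1, hm, coeff_Rt_succ_add_single_three t F G w hn1, coeff_Rt_succ_add_single_three t F G w hnw]
    exact hC2 _ _ (isUpperSet_cyl hF w) (isUpperSet_cyl hG w) n v hnv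

/-- **C2 AT LEVEL `3` HOLDS AT EVERY PROFILE WITH A TRIPLED (OR HIGHER) VERTEX** (unconditionally, from C2 at level `2`,
`…SahiCTCC2LevelTwo.coeff_Rt_two_C2`): for up-sets `𝒳, 𝒵`, `v ≠ w`, `m_v = 2`, `m_w ≥ 3`: `coeff_{m+e_v} R_3 ≤ coeff_m R_3`.  Hence the level-3 conjecture
C2 (⇒ `R_3 ∈ ℕ[s]`) only concerns profiles all of whose entries off `v` are `≤ 2`. [this work] -/
theorem coeff_Rt_three_C2_of_three_le {F G : Finset (Finset α)} (hF : IsUpperSet (F : Set (Finset α))) (hG : IsUpperSet (G : Set (Finset α)))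
    {m : α →₀ ℕ} {v w : α} (hvw : v ≠ w) (hv : m v = 2) (hw : 3 ≤ m w) :
    (Rt 3 F G).coeff (m + Finsupp.single v 1) ≤ (Rt 3 F G).coeff m :=
  coeff_Rt_succ_C2_of_three_le (t := 2) (fun _ _ hF' hG' m' v' hv' => coeff_Rt_two_C2 hF' hG' m' v' hv') hF hG hvw hv hw

end Summit.CriticalPhenomena.PercolationContinuityZ3.Theorems.SahiCTCForms
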